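import Summits.HodgeConjecture.HodgeConjecture.Theses.NikulinTwinTransport
import Summits.HodgeConjecture.HodgeConjecture.Theorems.NikulinTwinTransportTwinSimilitudeAlgebraicMarkings
import Summits.HodgeConjecture.HodgeConjecture.Theorems.NikulinTwinTransportTwinSimilitudeAlgebraicHKMarkedSqLemmas
import Literature.AlgebraicGeometry.Surfaces.K3HodgeTypesHolds
import Literature.AlgebraicGeometry.Surfaces.K3SurfaceProofs
import Literature.AlgebraicGeometry.HodgeTheory.SupportedClassesRationalProofs
import HarnessLib

/-!
# Route NikulinTwinTransport · crux X = `TwinSimilitudeAlgebraic` (stmt-HodgeConjecture-13674) —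
# line `hyperkaehler-nikulin-anchors`, heart assembly: `T(S)` ON THE CARRIERS vs IN A MARKING

The K3-side bridge of the heart `HKTwinClassAssembly`
(`Cruxes/TwinSimilitudeAlgebraic/Lines/hyperkaehler_nikulin_anchors.lean`, reshape r2).  The route
items read "transcendental" on the tree's carriers — `Perp[S ; y]`: `y` is cup-orthogonal to every
divisor class `d ∈ N¹H²(S(ℂ)) = algebraicClasses S 1` — while the hyperkähler facts read it in a
marking — `Tr[η y ; x]`: `η y` is orthogonal to every rational lattice vector orthogonal to the
period `x`.  For a marked projective K3 surface the two agree,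

  `perp_iff_tr : Perp[S ; y] ↔ Tr[η y ; x]`,

granted the two `(1,1)` route items of NikulinTwinTransport taken by name: `LefschetzOneOneK3`
(rational `(1,1)`-classes are algebraic; stmt-HodgeConjecture-13678) and `AlgebraicClassesOneOneK3`
(algebraic divisor classes are `(1,1)`; stmt-HodgeConjecture-15041), together with the tree's
theorems `Huybrechts_K3_hodgeTypes_H2_holds` (`H^{1,1} = ⟨σ, σ̄⟩^⊥`),
`supportedClasses_eq_span_isRationalClass` (`N¹H²` is spanned by its rational classes),
`isRationalClass_iff_of_marking` (rational classes are `Λ_ℚ`) and `conjClass_marking_symm`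
(markings are real).  No definitions, no named facts.  Prover seat
prover-line-stmt-HodgeConjecture-13674-c1-0 (line lead).

## References

* [Huybrechts2016K3] D. Huybrechts, Lectures on K3 Surfaces, CUP 2016, Ch. 3 Def. 2.5, Lemma 3.1
  (`T(X) = NS(X)^⊥`), Ch. 1 §3.3 (Lefschetz `(1,1)` for K3), Ch. 6 Prop. 1.2.
-/

noncomputable section

set_option linter.dupNamespace false

open CategoryTheory
open Literature.AlgebraicGeometry.Motives Literature.AlgebraicGeometry.HodgeTheory
open Literature.AlgebraicGeometry.Surfaces
open Literature.AlgebraicTopology.SingularHomology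
open Summit.HodgeConjecture.HodgeConjecture.Theses.NikulinTwinTransport

namespace Summit.HodgeConjecture.HodgeConjecture.Theorems.NikulinTwinTransport

/-- `MarkedK3[S, η, p, x]`: the six K3 marking clauses (verbatim those of the route's Theorems
files / `Surfaces.Huybrechts_K3_marking_exists`). Local notation only. -/
local notation3 (prettyPrint := false) "MarkedK3[" S ", " η ", " p ", " x "]" =>
  (IsIntegralClass p ∧
    (∀ q : complexBetti S (2 * 2), IsIntegralClass q → ∃ n : ℤ, q = n • p) ∧
    (∀ c : complexBetti S (2 * 1), IsIntegralClass c ↔ ∃ v : K3Index → ℤ, η c = fun i => (v i : ℂ)) ∧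
    (∀ a b : complexBetti S (2 * 1),
        cupProduct (rfl : 2 * 1 + 2 * 1 = 2 * 2) a b = k3Form (η a) (η b) • p) ∧
    IsOfHodgeType 2 S (2 * 1) 2 0 (LinearEquiv.symm η x) ∧
    (∀ τ : complexBetti S (2 * 1), IsOfHodgeType 2 S (2 * 1) 2 0 τ → ∃ t : ℂ, τ = t • LinearEquiv.symm η x))

/-- `Perp[S ; x]`: cup-orthogonality to the divisor classes `algebraicClasses S 1` (verbatim the
notation of the route items and of `IsPartialTwinClass`). Local notation only. -/
local notation3 (prettyPrint := false) "Perp[" S " ; " x "]" =>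
  ∀ d ∈ algebraicClasses S 1, cupProduct (rfl : 2 * 1 + 2 * 1 = 2 * 2) x d = 0

/-- `Tr[w ; x]`: orthogonality in `Λ_ℂ` to the rational vectors orthogonal to the period (verbatim
the notation of `Hyperkaehler.CamereEtAl2023_fixedK3_restriction`). Local notation only. -/
local notation3 (prettyPrint := false) "Tr[" w " ; " x "]" =>
  (∀ v : K3Index → ℚ, k3Form (fun i => ((v i : ℚ) : ℂ)) x = 0 → k3Form (fun i => ((v i : ℚ) : ℂ)) w = 0)

section PerpTr

variable {S : SchemeOver ℂ} (hS : IsK3Surface S)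
  (η : complexBetti S (2 * 1) ≃ₗ[ℂ] (K3Index → ℂ)) (p : complexBetti S (2 * 2)) (x : K3Index → ℂ)

include hS

/-- **A rational lattice vector orthogonal to the period is an ALGEBRAIC divisor class** (granted
Lefschetz `(1,1)` for K3): `η⁻¹ v` is rational (`isRationalClass_iff_of_marking`) and of type
`(1,1)` — cup-orthogonal to `σ = η⁻¹ x` (`(v.x) = 0`) and to `σ̄ = η⁻¹ x̄` (`v` is real), which is
`H^{1,1}` by `Huybrechts_K3_hodgeTypes_H2_holds`. [cite: Huybrechts2016K3, Ch. 1 §3.3 and Ch. 3 Lemma 3.1] -/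
theorem mem_algebraicClasses_of_ratCast_orthogonal (hL : LefschetzOneOneK3)
    (hmk : MarkedK3[S, η, p, x]) (hx : x ≠ 0) {v : K3Index → ℚ}
    (hv : k3Form (fun i => ((v i : ℚ) : ℂ)) x = 0) :
    η.symm (fun i => ((v i : ℚ) : ℂ)) ∈ algebraicClasses S 1 := by
  obtain ⟨-, -, hint, hcup, h20, -⟩ := hmk
  have hσ0 : η.symm x ≠ 0 := fun h => hx (by simpa using congrArg η h)
  obtain ⟨-, -, h11⟩ := Huybrechts_K3_hodgeTypes_H2_holds S hS (η.symm x) h20 hσ0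
  refine hL S hS _ ((isRationalClass_iff_of_marking hS η hint _).2 ⟨v, η.apply_symm_apply _⟩)
    ((h11 _).2 ⟨?_, ?_⟩)
  · rw [hcup, η.apply_symm_apply, η.apply_symm_apply, hv, zero_smul]
  · rw [conjClass_marking_symm η hint x, hcup, η.apply_symm_apply, η.apply_symm_apply,
      ← star_ratCast_pi v, ← star_k3Form, hv, star_zero, zero_smul]

/-- **A rational algebraic divisor class is a rational lattice vector orthogonal to the period**
(granted "algebraic ⟹ `(1,1)`" for K3). [cite: Huybrechts2016K3, Ch. 3 Lemma 3.1] -/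
theorem exists_ratCast_orthogonal_of_mem_algebraicClasses (hN : AlgebraicClassesOneOneK3)
    (hmk : MarkedK3[S, η, p, x]) (hx : x ≠ 0) (hp0 : p ≠ 0) {d : complexBetti S (2 * 1)}
    (hdrat : IsRationalClass d) (hd : d ∈ algebraicClasses S 1) :
    ∃ v : K3Index → ℚ, η d = (fun i => ((v i : ℚ) : ℂ)) ∧ k3Form (fun i => ((v i : ℚ) : ℂ)) x = 0 := by
  obtain ⟨-, -, hint, hcup, h20, -⟩ := hmk
  have hσ0 : η.symm x ≠ 0 := fun h => hx (by simpa using congrArg η h)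
  obtain ⟨-, -, h11⟩ := Huybrechts_K3_hodgeTypes_H2_holds S hS (η.symm x) h20 hσ0
  obtain ⟨v, hv⟩ := (isRationalClass_iff_of_marking hS η hint d).1 hdrat
  obtain ⟨hdσ, -⟩ := (h11 d).1 (hN S hS d hd)
  refine ⟨v, hv, ?_⟩
  rw [hcup, η.apply_symm_apply, hv, smul_eq_zero] at hdσ
  exact hdσ.resolve_right hp0

/-- **`Perp[S ; y] ↔ Tr[η y ; x]` for a marked projective K3 surface** (module docstring): the
carrier-side and the marking-side transcendental conditions agree, granted the two `(1,1)` route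
items.  `⟹`: rational vectors orthogonal to `x` are algebraic divisor classes
(`mem_algebraicClasses_of_ratCast_orthogonal`); `⟸`: `N¹H²` is the span of its RATIONAL classes
(`supportedClasses_eq_span_isRationalClass`), each a rational lattice vector orthogonal to `x`
(`exists_ratCast_orthogonal_of_mem_algebraicClasses`), and `y ∪ –` is linear.
[cite: Huybrechts2016K3, Ch. 3 Def. 2.5 and Lemma 3.1] -/
theorem perp_iff_tr (hL : LefschetzOneOneK3) (hN : AlgebraicClassesOneOneK3)
    (hmk : MarkedK3[S, η, p, x]) (hx : x ≠ 0) (hp0 : p ≠ 0) (y : complexBetti S (2 * 1)) :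
    Perp[S ; y] ↔ Tr[η y ; x] := by
  have hcup := hmk.2.2.2.1
  constructor
  · intro hP v hv
    have h := hP _ (mem_algebraicClasses_of_ratCast_orthogonal hS η p x hL hmk hx hv)
    rw [hcup, η.apply_symm_apply, smul_eq_zero] at h
    rw [k3Form_comm]
    exact h.resolve_right hp0
  · intro hT d hd
    -- reduce to rational algebraic classes by linearity of `y ∪ –`
    have key : ∀ d : complexBetti S (2 * 1), IsRationalClass d → d ∈ algebraicClasses S 1 →
        cupProduct (rfl : 2 * 1 + 2 * 1 = 2 * 2) y d = 0 := by
      intro d hdrat hd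
      obtain ⟨v, hv, hvx⟩ :=
        exists_ratCast_orthogonal_of_mem_algebraicClasses hS η p x hN hmk hx hp0 hdrat hd
      rw [hcup, hv, k3Form_comm, hT v hvx, zero_smul]
    have hspan : d ∈ Submodule.span ℂ
        {c : complexBetti S (2 * 1) | IsRationalClass c ∧ c ∈ algebraicClasses S 1} := by
      have h := supportedClasses_eq_span_isRationalClass hS.1 (2 * 1) 1
      change supportedClasses S (2 * 1) 1 = _ at h
      change d ∈ supportedClasses S (2 * 1) 1 at hd
      rwa [h] at hd
    refine Submodule.span_induction (p := fun d _ => cupProduct (rfl : 2 * 1 + 2 * 1 = 2 * 2) y d = 0)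
      (fun c hc => key c hc.1 hc.2) (by rw [map_zero]) (fun a b _ _ ha hb => by rw [map_add, ha, hb, add_zero])
      (fun t c _ hc => by rw [map_smul, hc, smul_zero]) hspan

end PerpTr

/-- Registered anchor of this helper file (closed form of `perp_iff_tr`).
[cite: Huybrechts2016K3, Ch. 3 Def. 2.5 and Lemma 3.1] -/
theorem hkPerpTr_anchor : ∀ {S : SchemeOver ℂ}, IsK3Surface S → ∀ (η : complexBetti S (2 * 1) ≃ₗ[ℂ] (K3Index → ℂ)) (p : complexBetti S (2 * 2)) (x : K3Index → ℂ), LefschetzOneOneK3 → AlgebraicClassesOneOneK3 → MarkedK3[S, η, p, x] → x ≠ 0 → p ≠ 0 → ∀ (y : complexBetti S (2 * 1)), (Perp[S ; y] ↔ Tr[η y ; x]) :=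
  fun hS η p x hL hN hmk hx hp0 y => perp_iff_tr hS η p x hL hN hmk hx hp0 y

end Summit.HodgeConjecture.HodgeConjecture.Theorems.NikulinTwinTransport

end
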